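import Summits.Ventures.WeilGRH.UniformConductorFloorLog10TableValidA
import HarnessLib

/-!
# GRH arm (rh-explicit, venture WeilGRH): the special-value table `Log10Table` — validity of the records of the modes `56 … 73`
  (kernel certificate, part D of H)

Cell `rh-explicit`, WEIL TRACK — GRH ARM (weil-grh-1 gen10; re-cut of gen9's sequential chain).  `checkTable` slice `[56, 74)` of
`UniformConductorFloorLog10Table.lean` (recompute `Encl.idxRec` at every mode, test containment; ≈ 5 s per mode in the kernel).  The parts after A import
part A only and file in parallel; they are glued into `tab_valid` in `UniformConductorFloorLog10TableValid.lean`.  Slice width `18` at this window (the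
widths differ between the five tables of the arm so that no two slice certificates have the same normalised statement).
No definitions; no named facts; standard axioms. [cite: Moore1966, Ch. 3 (interval arithmetic: inclusion property)]
-/

set_option maxRecDepth 200000

namespace Summit.Ventures.WeilGRH.Log10Table
open Literature.NumberTheory.LFunctions Literature.NumberTheory.LFunctions.Yoshida1992 Encl Literature.Analysis.ValidatedNumerics.NumericsMP

/-- kernel: table slice `[56, 74)`. [cite: Moore1966, Ch. 3 (interval arithmetic: inclusion property)] -/
theorem tT56 : checkTable prm C tab 56 18 = true := by decide +kernel

end Summit.Ventures.WeilGRH.Log10Table
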